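import Summits.CriticalPhenomena.Ising3DConformalLimit.Theorems.EnergyNotSigmaSquaredMoebiusLimitExistsLocallyBounded
import Summits.CriticalPhenomena.Ising3DConformalLimit.Theorems.EnergyNotSigmaSquaredMoebiusLimitExistsEquicontinuousTwo
import Summits.CriticalPhenomena.Ising3DConformalLimit.Theses.MonotoneRG
import Summits.CriticalPhenomena.Ising3DConformalLimit.Theses.MirrorHoelderCompactness
import HarnessLib

/-!
# Uniform regularity of the pinned zoom and precompactness of the critical orbit
(line `only-interaction-breaks-moebius` of the crux `MoebiusLimitExists`, item stmt-CriticalPhenomena-1344;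
registered stubs `uniformRegularity_of_seqEquicont` and `orbitPrecompact_of_seqCompact`)

With the PINNED renormalisation `ρ_pin(δ) = ⟨σ₀σ_{⌊1/δ⌋e₀}⟩_{β_c}^{-1/2}` (`rhoPin`) the pinned zoom of
the critical `ℤ³` correlators is `F_n(δ)(x) = ρ_pin(δ)ⁿ ⟨σ_{[x₁/δ]} ⋯ σ_{[xₙ/δ]}⟩_{β_c}`
(`rescaledCorrelator (criticalCorr 3) rhoPin n δ x`). Along every mesh SEQUENCE `u k → 0⁺` the line has:
eventual local bounds (`pinnedZoomLocallyBounded`, under the two-point law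
`⟨σ₀σ_y⟩_{β_c}‖y‖₂^{2Δ} → c > 0`, item stmt-0634 passed as data), uniform convergence of the PAIR zoom
on compacts to `‖x 1 − x 0‖^{-2Δ}` (`tendstoUniformlyOn_rescaledCorrelator_two`), and — as a
hypothesis here — eventual asymptotic equicontinuity at all orders.

* `uniformRegularity_of_seqEquicont`: the routine upgrade from "along every sequence `u k → 0⁺`,
  eventually in `k`" to "for all `δ ∈ (0, δ₀)`" (`exists_forall_Ioo_of_seq`: if the uniform statement
  failed for every `δ₀ = 1/(j+1)`, the witnesses `δ_j → 0⁺` would contradict the sequential statement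
  at large `j`), giving the three clauses of item stmt-4658
  `MirrorHoelderCompactness.UniformRegularity` — (a) uniform bound, (b) uniform equicontinuity,
  (c) a positive lower bound for the pair zoom on compacts (half the minimum of the positive
  continuous limit `‖x 1 − x 0‖^{-2Δ}` on the compact set). The renormalisation of item 4658,
  `δ ↦ ⟨σ₀σ_{⌊δ⁻¹⌋e₀}⟩^{-1/2}`, IS `rhoPin` (`⌊δ⁻¹⌋ = ⌊1/δ⌋`).
* `orbitPrecompact_of_seqCompact`: bookkeeping — sequential compactness of the pinned zoom plus
  non-degeneracy of its cluster points is item `MonotoneRG.OrbitPrecompact` with `ρ := ρ_pin`.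

References: folklore real analysis (subsequence principle; `tendsto_nhdsWithin_iff`,
`IsCompact.exists_isMinOn`). No definitions are introduced.
-/

noncomputable section

open Filter Topology Set Function Metric
open Literature.Probability.LatticeModels

namespace Summit.CriticalPhenomena.Ising3DConformalLimit.MoebiusLimitExistsOnlyInteraction

/-! ### Sequential-to-uniform upgrade -/

/-- **Sequential-to-uniform upgrade near `0⁺`.** Let `P j δ` be a property of a level `j : ℕ` and a
mesh `δ : ℝ`, monotone in the level. If along every sequence `u k → 0⁺` some level holds eventually,
then some level holds for ALL `δ ∈ (0, δ₀)`, for some `δ₀ > 0`: otherwise, for every `j`, level `j`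
fails at some `δ_j ∈ (0, 1/(j+1))`; `δ_j → 0⁺`, so some level `j₀` holds at `δ_k` for all large `k`,
hence level `k ≥ j₀` holds at `δ_k` — a contradiction. [folklore] -/
theorem exists_forall_Ioo_of_seq {P : ℕ → ℝ → Prop} (hmono : ∀ j δ, P j δ → P (j + 1) δ)
    (hseq : ∀ u : ℕ → ℝ, Tendsto u atTop (𝓝[>] (0 : ℝ)) → ∃ j, ∀ᶠ k in atTop, P j (u k)) :
    ∃ (j : ℕ) (δ₀ : ℝ), 0 < δ₀ ∧ ∀ δ ∈ Set.Ioo 0 δ₀, P j δ := by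
  by_contra H
  push Not at H
  have H' : ∀ j : ℕ, ∃ δ ∈ Set.Ioo (0 : ℝ) (1 / ((j : ℝ) + 1)), ¬ P j δ := fun j =>
    H j _ Nat.one_div_pos_of_nat
  choose u hu hPu using H'
  have hu0 : Tendsto u atTop (𝓝[>] (0 : ℝ)) := by
    rw [tendsto_nhdsWithin_iff]
    refine ⟨?_, Eventually.of_forall fun k => (hu k).1⟩
    exact squeeze_zero (fun k => (hu k).1.le) (fun k => (hu k).2.le)
      tendsto_one_div_add_atTop_nhds_zero_nat
  obtain ⟨j₀, hj₀⟩ := hseq u hu0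
  have hmono' : ∀ (δ : ℝ) {j j' : ℕ}, j ≤ j' → P j δ → P j' δ := by
    intro δ j j' hjj' hP
    induction hjj' with
    | refl => exact hP
    | step _ ih => exact hmono _ _ ih
  obtain ⟨k, hk₁, hk₂⟩ := (hj₀.and (eventually_ge_atTop j₀)).exists
  exact hPu k (hmono' (u k) hk₂ hk₁)

/-! ### The three clauses of `UniformRegularity` for the pinned zoom -/

/-- Clause (a): under the two-point law, on every compact set of non-coincident configurations the
pinned zoom is bounded, uniformly in `x ∈ K` and `δ ∈ (0, δ₀)` (upgrade of
`pinnedZoomLocallyBounded`, levels `j ↦ "bound j"`). [folklore] -/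
theorem uniformBound_rhoPin {Δ c : ℝ} (hc : 0 < c)
    (hG : Tendsto (fun y : Site 3 => criticalTwoPoint 3 y * Real.sqrt (∑ i, ((y i : ℝ)) ^ 2) ^ (2 * Δ))
      cofinite (𝓝 c))
    (n : ℕ) {K : Set (Fin n → EuclideanSpace ℝ (Fin 3))} (hK : IsCompact K)
    (hKs : K ⊆ NonCoincident 3 n) :
    ∃ M δ₀ : ℝ, 0 < δ₀ ∧ ∀ δ ∈ Set.Ioo 0 δ₀, ∀ x ∈ K,
      |rescaledCorrelator (criticalCorr 3) rhoPin n δ x| ≤ M := by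
  obtain ⟨j, δ₀, hδ₀, hj⟩ := exists_forall_Ioo_of_seq
    (P := fun j δ => ∀ x ∈ K, |rescaledCorrelator (criticalCorr 3) rhoPin n δ x| ≤ j)
    (fun j δ h x hx => (h x hx).trans (by push_cast; linarith))
    (fun u hu => by
      obtain ⟨B, hB⟩ := pinnedZoomLocallyBounded Δ c hc hG u hu n K hK hKs
      exact ⟨⌈B⌉₊, hB.mono fun k hk x hx => (hk x hx).trans (Nat.le_ceil B)⟩)
  exact ⟨j, δ₀, hδ₀, hj⟩

/-- Clause (b): sequential asymptotic equicontinuity of the pinned zoom on compacts (eventually along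
every mesh sequence `u k → 0⁺`) upgrades to equicontinuity uniformly in `δ ∈ (0, δ₀)` (levels
`j ↦ "modulus 1/(j+1)"`). [folklore] -/
theorem uniformEquicontinuous_rhoPin
    (hE : ∀ u : ℕ → ℝ, Tendsto u atTop (𝓝[>] (0 : ℝ)) →
      ∀ (n : ℕ) (K : Set (Fin n → EuclideanSpace ℝ (Fin 3))), IsCompact K → K ⊆ NonCoincident 3 n →
        ∀ ε > 0, ∃ η > 0, ∀ᶠ k in atTop, ∀ x ∈ K, ∀ y ∈ K, dist x y < η →
          |rescaledCorrelator (criticalCorr 3) rhoPin n (u k) x -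
            rescaledCorrelator (criticalCorr 3) rhoPin n (u k) y| < ε)
    (n : ℕ) {K : Set (Fin n → EuclideanSpace ℝ (Fin 3))} (hK : IsCompact K)
    (hKs : K ⊆ NonCoincident 3 n) {ε : ℝ} (hε : 0 < ε) :
    ∃ r δ₀ : ℝ, 0 < r ∧ 0 < δ₀ ∧ ∀ δ ∈ Set.Ioo 0 δ₀, ∀ x ∈ K, ∀ y ∈ K, dist x y < r →
      |rescaledCorrelator (criticalCorr 3) rhoPin n δ x -
        rescaledCorrelator (criticalCorr 3) rhoPin n δ y| < ε := by
  obtain ⟨j, δ₀, hδ₀, hj⟩ := exists_forall_Ioo_of_seq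
    (P := fun j δ => ∀ x ∈ K, ∀ y ∈ K, dist x y < 1 / ((j : ℝ) + 1) →
      |rescaledCorrelator (criticalCorr 3) rhoPin n δ x -
        rescaledCorrelator (criticalCorr 3) rhoPin n δ y| < ε)
    (fun j δ h x hx y hy hxy => h x hx y hy (hxy.trans_le (by
      have := Nat.one_div_le_one_div (α := ℝ) (Nat.le_succ j)
      push_cast at this ⊢
      exact this)))
    (fun u hu => by
      obtain ⟨η, hη, hev⟩ := hE u hu n K hK hKs ε hε
      obtain ⟨j, hjη⟩ := exists_nat_one_div_lt hη
      exact ⟨j, hev.mono fun k hk x hx y hy hxy => hk x hx y hy (hxy.trans hjη)⟩)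
  exact ⟨1 / ((j : ℝ) + 1), δ₀, Nat.one_div_pos_of_nat, hδ₀, hj⟩

/-- Clause (c): under the two-point law, on every compact set `K` of non-coincident pairs the pinned
pair zoom is bounded below by a positive constant, uniformly in `δ ∈ (0, δ₀)`: the limit
`f x = ‖x 1 − x 0‖^{-2Δ}` is continuous and positive on `K`, so (for `K ≠ ∅`) has a positive minimum
`2m`; the pair zoom is uniformly `m`-close to `f` on `K` eventually along every mesh sequence
(`tendstoUniformlyOn_rescaledCorrelator_two`), hence `≥ m` there, and the upgrade applies (constant
levels). [folklore] -/
theorem uniformLowerBound_rhoPin_two {Δ c : ℝ} (hc : 0 < c)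
    (hG : Tendsto (fun y : Site 3 => criticalTwoPoint 3 y * Real.sqrt (∑ i, ((y i : ℝ)) ^ 2) ^ (2 * Δ))
      cofinite (𝓝 c))
    {K : Set (Fin 2 → EuclideanSpace ℝ (Fin 3))} (hK : IsCompact K) (hKs : K ⊆ NonCoincident 3 2) :
    ∃ m δ₀ : ℝ, 0 < m ∧ 0 < δ₀ ∧ ∀ δ ∈ Set.Ioo 0 δ₀, ∀ x ∈ K,
      m ≤ rescaledCorrelator (criticalCorr 3) rhoPin 2 δ x := by
  rcases K.eq_empty_or_nonempty with rfl | hKne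
  · exact ⟨1, 1, one_pos, one_pos, fun δ _ x hx => (Set.notMem_empty x hx).elim⟩
  -- the limit pair function, continuous and positive on `K`, has a positive minimum `f x₀`
  have hcont : ContinuousOn (fun x : Fin 2 → EuclideanSpace ℝ (Fin 3) => ‖x 1 - x 0‖ ^ (-(2 * Δ))) K :=
    fun x hx => (continuousAt_norm_sub_rpow Δ
      (((mem_nonCoincident x).1 (hKs hx)).ne (by decide))).continuousWithinAt
  obtain ⟨x₀, hx₀, hmin⟩ := hK.exists_isMinOn hKne hcont
  rw [isMinOn_iff] at hmin
  have h01 : x₀ 0 ≠ x₀ 1 := ((mem_nonCoincident x₀).1 (hKs hx₀)).ne (by decide)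
  have hpos : 0 < ‖x₀ 1 - x₀ 0‖ ^ (-(2 * Δ)) :=
    Real.rpow_pos_of_pos (norm_pos_iff.2 (sub_ne_zero.2 h01.symm)) _
  set m : ℝ := ‖x₀ 1 - x₀ 0‖ ^ (-(2 * Δ)) / 2 with hm
  have hm0 : 0 < m := by positivity
  obtain ⟨_, δ₀, hδ₀, hj⟩ := exists_forall_Ioo_of_seq
    (P := fun _ δ => ∀ x ∈ K, m ≤ rescaledCorrelator (criticalCorr 3) rhoPin 2 δ x)
    (fun _ _ h => h)
    (fun u hu => by
      have hev := Metric.tendstoUniformlyOn_iff.1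
        (tendstoUniformlyOn_rescaledCorrelator_two (Δ := Δ) hc hG hu hK hKs) m hm0
      refine ⟨0, hev.mono fun k hk x hx => ?_⟩
      have h1 := hk x hx
      rw [Real.dist_eq, abs_sub_lt_iff] at h1
      have h2 := hmin x hx
      linarith [h1.1, h1.2])
  exact ⟨m, δ₀, hm0, hδ₀, hj⟩

/-! ### The stubs -/

/-- **Registered stub `uniformRegularity_of_seqEquicont` (line `only-interaction-breaks-moebius`).**
Under the two-point law `⟨σ₀σ_y⟩_{β_c}‖y‖₂^{2Δ} → c > 0` (item stmt-0634, passed as data) and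
sequential asymptotic equicontinuity of the pinned zoom at all orders (eventually along every mesh
sequence `u k → 0⁺`, on every compact set of non-coincident configurations), item stmt-4658
`MirrorHoelderCompactness.UniformRegularity` holds: (a) uniform bounds (`uniformBound_rhoPin`, from
`pinnedZoomLocallyBounded`), (b) uniform equicontinuity (`uniformEquicontinuous_rhoPin`), (c) a positive
lower bound for the pair zoom (`uniformLowerBound_rhoPin_two`, from
`tendstoUniformlyOn_rescaledCorrelator_two`), all for `δ ∈ (0, δ₀)`; the renormalisation of item 4658,
`δ ↦ ⟨σ₀σ_{⌊δ⁻¹⌋e₀}⟩^{-1/2}`, is `ρ_pin` (`⌊δ⁻¹⌋ = ⌊1/δ⌋`). [folklore] -/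
theorem uniformRegularity_of_seqEquicont : ∀ (Δ c : ℝ), 0 < c → Tendsto (fun y : Site 3 => criticalTwoPoint 3 y * Real.sqrt (∑ i, ((y i : ℝ)) ^ 2) ^ (2 * Δ)) cofinite (𝓝 c) → (∀ u : ℕ → ℝ, Tendsto u atTop (𝓝[>] (0 : ℝ)) → ∀ (n : ℕ) (K : Set (Fin n → EuclideanSpace ℝ (Fin 3))), IsCompact K → K ⊆ NonCoincident 3 n → ∀ ε > 0, ∃ η > 0, ∀ᶠ k in atTop, ∀ x ∈ K, ∀ y ∈ K, dist x y < η → |rescaledCorrelator (criticalCorr 3) rhoPin n (u k) x - rescaledCorrelator (criticalCorr 3) rhoPin n (u k) y| < ε) → Summit.CriticalPhenomena.Ising3DConformalLimit.Theses.MirrorHoelderCompactness.UniformRegularity := by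
  intro Δ c hc hG hE
  -- the renormalisation of item 4658, `δ ↦ ⟨σ₀σ_{⌊δ⁻¹⌋e₀}⟩^{-1/2}`, is `ρ_pin` (`⌊δ⁻¹⌋ = ⌊1/δ⌋`)
  have hρ : (fun δ : ℝ => (criticalTwoPoint 3 (Pi.single 0 ⌊δ⁻¹⌋)) ^ (-(1/2:ℝ))) = rhoPin := by
    funext δ
    simp only [rhoPin, one_div]
  unfold Theses.MirrorHoelderCompactness.UniformRegularity
  rw [hρ]
  exact ⟨fun n K hKs hK => ⟨uniformBound_rhoPin hc hG n hK hKs,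
    fun ε hε => uniformEquicontinuous_rhoPin hE n hK hKs hε⟩,
    fun K hKs hK => uniformLowerBound_rhoPin_two hc hG hK hKs⟩

/-- **Registered stub `orbitPrecompact_of_seqCompact` (line `only-interaction-breaks-moebius`).**
Sequential compactness of the pinned zoom (every mesh sequence `u k → 0⁺` has a subsequence along
which all pinned rescaled critical correlators converge locally uniformly off the diagonals to a
regular family) together with non-degeneracy of every cluster point gives item
`MonotoneRG.OrbitPrecompact` with the renormalisation `ρ := ρ_pin` (`rhoPin_pos`; a mesh sequence in
`(0,1]` tending to `0` tends to `0⁺`, `tendsto_nhdsWithin_iff`; the subsequential limit is a cluster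
point, `isClusterPoint_of_subseq`). [folklore] -/
theorem orbitPrecompact_of_seqCompact : (∀ u : ℕ → ℝ, Tendsto u atTop (𝓝[>] (0 : ℝ)) → ∃ (φ : ℕ → ℕ) (S : CorrFamily 3), StrictMono φ ∧ IsRegular S ∧ ∀ n, TendstoLocallyUniformlyOn (fun k => rescaledCorrelator (criticalCorr 3) rhoPin n (u (φ k))) (S n) atTop (NonCoincident 3 n)) → (∀ S : CorrFamily 3, IsClusterPoint S → IsNondegenerateTwoPoint S) → Summit.CriticalPhenomena.Ising3DConformalLimit.Theses.MonotoneRG.OrbitPrecompact := by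
  intro hcpt hnd
  refine ⟨rhoPin, rhoPin_pos, fun u hu01 hu0 => ?_⟩
  have hu : Tendsto u atTop (𝓝[>] (0 : ℝ)) :=
    tendsto_nhdsWithin_iff.2 ⟨hu0, Eventually.of_forall fun k => (hu01 k).1⟩
  obtain ⟨φ, S, hφ, _hreg, hconv⟩ := hcpt u hu
  exact ⟨φ, S, hφ, hnd S (isClusterPoint_of_subseq hu hφ hconv), hconv⟩

end Summit.CriticalPhenomena.Ising3DConformalLimit.MoebiusLimitExistsOnlyInteraction

end
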